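import Summits.FinalStateConjecture.FinalStateConjecture.Theorems.PhotonSphereChannelsDuhamel

/-!
# Route PhotonSphereChannels — `C^n` parametric primitives and the Leibniz rule (well-posedness, I)

Finite-regularity companion of `PhotonSphereChannelsDuhamel` (which treats `C^∞` integrands).  The
Cauchy problem for `ψ_tt − ψ_xx + Vψ = 0` with `C²` data — stub `stub_rwCauchy` of the crux lines on
`UniformPhotonSphereChannels` (item stmt-FinalStateConjecture-10045) and the existence statement
`BlindnessInsidePhotonSphere` (stmt-…-10049) — is solved by Picard iteration of the Duhamel operator,
whose iterates are only finitely differentiable; so the parametric-integral calculus is needed for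
`C^n` integrands, `n : ℕ`:

* `contDiff_parametric_intervalIntegral_nat` — `H : ℝ × P → ℝ` of class `C^n` ⇒
  `p ↦ ∫ σ in a..b, H (σ, p)` is `C^n` (induction on `n` through
  `Literature.Analysis.FunctionSpaces.{hasFDerivAt_parametric_intervalIntegral,
  fderiv_parametric_intervalIntegral_apply}`; base case: continuity of parametric integrals);
* `contDiff_parametric_primitive_nat` — the primitive with variable upper limit
  `(τ, q) ↦ ∫ s in 0..τ, h (s, q)` is `C^n` (`θ`-trick), and for `h ∈ C¹` its partials are
  `∂Ψ(τ,q)(a,v) = a h(τ,q) + ∫₀^τ ∂h(s,q)(0,v)` (`fderiv_parametric_primitive_of_contDiff_one`);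
* the Leibniz rule `contDiff_leibniz_nat` / `fderiv_leibniz_of_contDiff_one` for
  `K p = ∫ s in 0..p.1, J (s, p)`.

No new definitions. [folklore]
-/

namespace Summit.FinalStateConjecture.FinalStateConjecture.Theorems

open MeasureTheory Set Filter Topology intervalIntegral
open scoped ContDiff

noncomputable section

namespace WaveEnergy

/-! ### `C^n` dependence of fixed-limits parametric integrals on parameters -/

section ParamFinite

variable {P : Type*} [NormedAddCommGroup P] [NormedSpace ℝ P] [FiniteDimensional ℝ P]

/-- **`C^n` regularity of parametric integrals of `C^n` integrands** (`n : ℕ`): if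
`H : ℝ × P → ℝ` is `C^n` then so is `p ↦ ∫ σ in a..b, H (σ, p)` (induction on `n`: the
directional derivatives are parametric integrals of the `C^{n-1}` functions
`(σ, p) ↦ ∂H(σ,p)(0,v)`; the base case is continuity of parametric integrals). [folklore] -/
theorem contDiff_parametric_intervalIntegral_nat (a b : ℝ) :
    ∀ (n : ℕ) {H : ℝ × P → ℝ}, ContDiff ℝ n H → ContDiff ℝ n fun p : P => ∫ σ in a..b, H (σ, p)
  | 0, H, hH => by
    rw [Nat.cast_zero, contDiff_zero] at hH ⊢
    exact intervalIntegral.continuous_parametric_intervalIntegral_of_continuous'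
      (f := fun p σ => H (σ, p)) (hH.comp (continuous_snd.prodMk continuous_fst)) a b
  | n + 1, H, hH => by
    have h1 : ((n + 1 : ℕ) : WithTop ℕ∞) ≠ 0 := by exact_mod_cast Nat.succ_ne_zero n
    rw [Nat.cast_succ] at hH ⊢
    rw [contDiff_succ_iff_fderiv_apply]
    refine ⟨Literature.Analysis.FunctionSpaces.differentiable_parametric_intervalIntegral hH
      (by rw [← Nat.cast_succ]; exact h1) a b, fun h => ?_, fun v => ?_⟩
    · exact absurd h (by exact_mod_cast WithTop.coe_ne_top)
    · have hv : (fun p : P => fderiv ℝ (fun p : P => ∫ σ in a..b, H (σ, p)) p v) =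
          fun p : P => ∫ σ in a..b, fderiv ℝ H (σ, p) ((0 : ℝ), v) :=
        funext fun p => Literature.Analysis.FunctionSpaces.fderiv_parametric_intervalIntegral_apply
          hH (by rw [← Nat.cast_succ]; exact h1) a b p v
      rw [hv]
      refine contDiff_parametric_intervalIntegral_nat a b n
        (H := fun q => fderiv ℝ H q ((0 : ℝ), v)) ?_
      exact (hH.fderiv_right (m := n) le_rfl).clm_apply contDiff_const

end ParamFinite

/-! ### `C^n` parametric primitives and the Leibniz rule -/

section PrimitiveFinite

variable {Q : Type*} [NormedAddCommGroup Q] [NormedSpace ℝ Q] [FiniteDimensional ℝ Q]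

/-- **`C^n` parametric primitive**: for `h : ℝ × Q → ℝ` of class `C^n`, the primitive with variable
upper limit `(τ, q) ↦ ∫ s in 0..τ, h (s, q)` is `C^n` on `ℝ × Q`. [folklore] -/
theorem contDiff_parametric_primitive_nat (n : ℕ) {h : ℝ × Q → ℝ} (hh : ContDiff ℝ n h) :
    ContDiff ℝ n fun q : ℝ × Q => ∫ s in (0 : ℝ)..q.1, h (s, q.2) := by
  have heq : (fun q : ℝ × Q => ∫ s in (0 : ℝ)..q.1, h (s, q.2))
      = fun q : ℝ × Q => ∫ θ in (0 : ℝ)..1, q.1 * h (q.1 * θ, q.2) := by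
    funext q
    have h1 := intervalIntegral.smul_integral_comp_mul_left (f := fun s => h (s, q.2)) (a := (0 : ℝ))
      (b := 1) q.1
    simp only [mul_zero, mul_one, smul_eq_mul] at h1
    rw [intervalIntegral.integral_const_mul, h1]
  rw [heq]
  refine contDiff_parametric_intervalIntegral_nat 0 1 n
    (H := fun r : ℝ × (ℝ × Q) => r.2.1 * h (r.2.1 * r.1, r.2.2)) ?_
  have h1 : ContDiff ℝ n fun r : ℝ × (ℝ × Q) => (r.2.1 * r.1, r.2.2) := by fun_prop
  exact (contDiff_fst.comp contDiff_snd).mul (hh.comp h1)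

/-- **Partials of the `C¹` parametric primitive**: `∂Ψ(τ,q)(a,v) = a h(τ,q) + ∫₀^τ ∂h(s,q)(0,v)`.
[folklore] -/
theorem fderiv_parametric_primitive_of_contDiff_one {h : ℝ × Q → ℝ} (hh : ContDiff ℝ 1 h)
    (τ : ℝ) (q : Q) (a : ℝ) (v : Q) :
    fderiv ℝ (fun q : ℝ × Q => ∫ s in (0 : ℝ)..q.1, h (s, q.2)) (τ, q) (a, v)
      = a * h (τ, q) + ∫ s in (0 : ℝ)..τ, fderiv ℝ h (s, q) ((0 : ℝ), v) := by
  set Ψ : ℝ × Q → ℝ := fun q => ∫ s in (0 : ℝ)..q.1, h (s, q.2) with hΨ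
  have hΨd : Differentiable ℝ Ψ :=
    (contDiff_parametric_primitive_nat 1 (by exact_mod_cast hh)).differentiable (by simp)
  have hsplit : ((a, v) : ℝ × Q) = a • ((1 : ℝ), (0 : Q)) + ((0 : ℝ), v) := by ext <;> simp
  rw [hsplit, map_add, map_smul, smul_eq_mul]
  congr 1
  · have hc : Continuous fun s => h (s, q) := hh.continuous.comp (Continuous.prodMk_left q)
    have hftc : HasDerivAt (fun σ => Ψ (σ, q)) (h (τ, q)) τ := by
      simp only [hΨ]
      exact intervalIntegral.integral_hasDerivAt_right (hc.intervalIntegrable _ _)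
        hc.aestronglyMeasurable.stronglyMeasurableAtFilter hc.continuousAt
    rw [(hasDerivAt_slice_fst' hΨd τ q).unique hftc]
  · have h1 : fderiv ℝ Ψ (τ, q) ((0 : ℝ), v) = fderiv ℝ (fun p => Ψ (τ, p)) q v := by
      rw [(hasFDerivAt_slice_snd' hΨd τ q).fderiv]
      rfl
    rw [h1]
    simp only [hΨ]
    exact Literature.Analysis.FunctionSpaces.fderiv_parametric_intervalIntegral_apply
      (H := h) hh (by simp) 0 τ q v

/-- **`C^n` Leibniz rule**: `K p = ∫ s in 0..p.1, J (s, p)` is `C^n` for `J : ℝ × (ℝ × ℝ) → ℝ`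
of class `C^n`. [folklore] -/
theorem contDiff_leibniz_nat (n : ℕ) {J : ℝ × (ℝ × ℝ) → ℝ} (hJ : ContDiff ℝ n J) :
    ContDiff ℝ n fun p : ℝ × ℝ => ∫ s in (0 : ℝ)..p.1, J (s, p) :=
  (contDiff_parametric_primitive_nat (Q := ℝ × ℝ) n hJ).comp (contDiff_fst.prodMk contDiff_id)

/-- The Leibniz formula for `C¹` integrands:
`∂K(p)(v) = v₁ J (p₁, p) + ∫₀^{p₁} ∂J(s,p)(0,v) ds`. [folklore] -/
theorem fderiv_leibniz_of_contDiff_one {J : ℝ × (ℝ × ℝ) → ℝ} (hJ : ContDiff ℝ 1 J) (p v : ℝ × ℝ) :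
    fderiv ℝ (fun p : ℝ × ℝ => ∫ s in (0 : ℝ)..p.1, J (s, p)) p v
      = v.1 * J (p.1, p) + ∫ s in (0 : ℝ)..p.1, fderiv ℝ J (s, p) ((0 : ℝ), v) := by
  set Ψ : ℝ × (ℝ × ℝ) → ℝ := fun q => ∫ s in (0 : ℝ)..q.1, J (s, q.2) with hΨ
  have hΨs : ContDiff ℝ 1 Ψ := contDiff_parametric_primitive_nat (Q := ℝ × ℝ) 1 (by exact_mod_cast hJ)
  have hA : HasFDerivAt (fun p : ℝ × ℝ => ((p.1, p) : ℝ × (ℝ × ℝ)))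
      ((ContinuousLinearMap.fst ℝ ℝ ℝ).prod (ContinuousLinearMap.id ℝ (ℝ × ℝ))) p :=
    (hasFDerivAt_fst).prodMk (hasFDerivAt_id p)
  have hcomp : HasFDerivAt (Ψ ∘ fun p : ℝ × ℝ => ((p.1, p) : ℝ × (ℝ × ℝ)))
      ((fderiv ℝ Ψ (p.1, p)).comp
        ((ContinuousLinearMap.fst ℝ ℝ ℝ).prod (ContinuousLinearMap.id ℝ (ℝ × ℝ)))) p :=
    HasFDerivAt.comp p ((hΨs.differentiable (by simp)) (p.1, p)).hasFDerivAt hA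
  have heq : (fun p : ℝ × ℝ => ∫ s in (0 : ℝ)..p.1, J (s, p))
      = Ψ ∘ fun p : ℝ × ℝ => ((p.1, p) : ℝ × (ℝ × ℝ)) := by
    funext p; simp [hΨ]
  rw [heq, hcomp.fderiv]
  simp only [ContinuousLinearMap.coe_comp, Function.comp_apply, ContinuousLinearMap.prod_apply,
    ContinuousLinearMap.coe_fst', ContinuousLinearMap.coe_id', id_eq]
  exact fderiv_parametric_primitive_of_contDiff_one (Q := ℝ × ℝ) hJ p.1 p v.1 v

end PrimitiveFinite

end WaveEnergy

end

end Summit.FinalStateConjecture.FinalStateConjecture.Theorems
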